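import Summits.NavierStokesRegularity.NavierStokesRegularity.Theorems.SqueezeCycleRecurrentLiouvilleNearIdentityDSS
import Summits.NavierStokesRegularity.NavierStokesRegularity.Theorems.RellichScarApexLocalisationMovingCentrePersistence
import Summits.NavierStokesRegularity.NavierStokesRegularity.Theorems.SymmetryModuliCountForcedSymmetryStubSatelliteExclusionTools
import HarnessLib

/-!
# Crux `ForcedSymmetry` (stmt-NavierStokesRegularity-4052), line `recurrent-closing` gen 5, stub 3a
# `stub_satelliteExclusion`: the NEAR-IDENTITY factor range, without rotation — no satellites, no singular
# centre, wherever the centre is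

Support file (theorems only, `--supports stmt-NavierStokesRegularity-4052`; the same statement serves stub 1 AND stub 3
of crux stmt-NavierStokesRegularity-8561's line `birth` for `R = 1`, `1 < l < Λ`).

`satelliteExclusion_nearIdentity` — for every rate constant `C` and every bound `M < ⊤` there is `Λ = Λ(C, M) > 1`
such that every smooth profile `(w, q, H)` of Albritton–Barker's local Type-I class on the slab `ℝ³ × (−∞,0)` (suitable
weak, weak gradient, `𝐈 ≤ M`, rate `‖w(t,x)‖ ≤ C/√(−t)`, classical on `(−∞,0)`) which is invariant a.e. under ONE pure
similarity `(t, x) ↦ l w(l² t, l x + ξ)` with `1 < l < Λ` and ANY translation part `ξ` (i.e. discretely self-similar with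
factor `l` about the centre `c = ξ/(1 − l)` on the final slice) is regular at EVERY point `(0, y)` of the final slice —
the centre included.  For `ξ = 0`, `y = 0` this is the tree's `stub_rlNearIdentityDSS` (crux 1589, Chae–Wolf 2017 Thm 1.3
/ Pineau–Vicol 2026 Thm 1.6 in the Albritton–Barker class, no spatial decay assumed); the new content is the SATELLITE
case `y ≠ c` (gap (iii) of the printed rungs: Chae–Wolf 2017 Thm 1.1 proves off-centre regularity only in `C_t Lᵖ`), for
factors near `1`.

Proof (compactness, after Chae–Wolf).  Suppose profiles `w_k` with factors `l_k ↓ 1`, centres `c_k`, singular at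
`(0, y_k)`.  By orbit invariance of the final-slice singular set (`isBackwardSingularPoint_rdss_iterate_iff`, tools file)
the singular point may be pulled along the inverse orbit to distance `≤ 1` from the centre; translating it to the origin
(translation covariance of the class, `ApexLocalisation.Negative.Translate`) gives origin-singular class profiles `u_k`,
`l_k`-self-similar about centres `a_k`, `‖a_k‖ ≤ 1`.  A class limit `W` (`stub_rlClassLimit`: Albritton–Barker compactness
+ persistence) is singular at the origin; along a further subsequence `a_k → a_∞`, and the translates `u_k(·, a_k + ·)`
(DSS about the ORIGIN) converge in `L³_loc` to `W(·, a_∞ + ·)` (continuity of translation in `L³`,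
`tendsto_eLpNorm_translate_sub`).  The integer powers `l_k^{⌊σ/log l_k⌋} → e^σ` fix `u_k(·, a_k + ·)`, so
`W(·, a_∞ + ·)` is a.e. self-similar (`rlNearIdentityDSS_ball`, scaling-orbit continuity `stub_rlOrbitContinuous`), hence
a.e. a pointwise self-similar Type-I ancient mild field (`stub_rlSelfSimilarRepr`), which vanishes (Tsai 1998 Thm 1,
`stub_rlSelfSimilarMildVanishes`) — so `W = 0` a.e., contradicting its singular origin.

References: D. Chae, J. Wolf, Comm. PDE 42 (2017) = arXiv:1610.09464, Thms 1.1, 1.3 [ChaeWolf2017RemovingDSS];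
T.-P. Tsai, ARMA 143 (1998), Thm 1 [Tsai1998]; D. Albritton, T. Barker, JMFM 21 (2019), Lemma 2.2, Prop. 2.3
[AlbrittonBarker2019].
-/

noncomputable section

-- the summit and its single sub-problem share the name (CONVENTIONS §1), as in every Theorems file
set_option linter.dupNamespace false

open MeasureTheory Set Function Metric Filter Topology
open scoped ENNReal NNReal
open Literature.Analysis.FluidPDE
open Summit.NavierStokesRegularity.NavierStokesRegularity.Theorems.ApexLocalisation.Negative.Translate
open Summit.NavierStokesRegularity.NavierStokesRegularity.Theorems.RellichScarApexLocalisation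

namespace Summit.NavierStokesRegularity.NavierStokesRegularity.Theorems.SymmetryModuliCountForcedSymmetry

/-- **Translating a self-similar profile about its centre makes it self-similar about the origin**: if
`l w(l² t, l x + ξ) = w(t, x)` for `t < 0` and `c = l c + ξ`, then for every `b` the translate `u = w(·, b + ·)` satisfies
`l u(l²t, (c − b) + l (x − (c − b))) = u(t, x)`, i.e. `nsRescale l (translate (c - b) u) = translate (c - b) u` on `t < 0`.
[folklore] -/
theorem nsRescale_translate_translate_of_rdss {w : ℝ → EuclideanSpace ℝ (Fin 3) → EuclideanSpace ℝ (Fin 3)}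
    {l : ℝ} {ξ c : EuclideanSpace ℝ (Fin 3)}
    (hinv : ∀ t < (0 : ℝ), ∀ x : EuclideanSpace ℝ (Fin 3), l • w (l ^ 2 * t) (l • x + ξ) = w t x)
    (hc : c = l • c + ξ) (b : EuclideanSpace ℝ (Fin 3)) :
    ∀ t < (0 : ℝ), ∀ x : EuclideanSpace ℝ (Fin 3),
      nsRescale l (translate (c - b) (translate b w)) t x = translate (c - b) (translate b w) t x := by
  intro t ht x
  rw [nsRescale_apply]
  show l • w (l ^ 2 * t) (b + (c - b + l • x)) = w t (b + (c - b + x))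
  have key := hinv t ht (c + x)
  have hcc : l • (c + x) + ξ = c + l • x := by
    calc l • (c + x) + ξ = (l • c + ξ) + l • x := by rw [smul_add]; abel
      _ = c + l • x := by rw [← hc]
  rw [hcc] at key
  have e1 : b + (c - b + l • x) = c + l • x := by abel
  have e2 : b + (c - b + x) = c + x := by abel
  rw [e1, e2]
  exact key

/-- **A.e. vanishing on the slab is translation invariant** (the spatial shift preserves the slab and Lebesgue
measure). [folklore] -/
theorem ae_zero_slab_translate {W : ℝ → EuclideanSpace ℝ (Fin 3) → EuclideanSpace ℝ (Fin 3)} (a : EuclideanSpace ℝ (Fin 3))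
    (h : ∀ᵐ z ∂(volume.restrict (Iio (0 : ℝ) ×ˢ (univ : Set (EuclideanSpace ℝ (Fin 3))))),
      uncurry W z = (0 : EuclideanSpace ℝ (Fin 3))) :
    ∀ᵐ z ∂(volume.restrict (Iio (0 : ℝ) ×ˢ (univ : Set (EuclideanSpace ℝ (Fin 3))))),
      uncurry (translate a W) z = (0 : EuclideanSpace ℝ (Fin 3)) := by
  have hmp := (measurePreserving_spaceShift a).restrict_preimage
    ((measurableSet_Iio (a := (0 : ℝ))).prod (MeasurableSet.univ (α := EuclideanSpace ℝ (Fin 3))))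
  rw [spaceShift_preimage_lowerHalf] at hmp
  have h' := hmp.quasiMeasurePreserving.ae h
  filter_upwards [h'] with z hz
  exact hz

/-- **Near-identity discretely self-similar profiles of the Albritton–Barker class have no final-slice singular point
— centre or satellite — wherever the centre is.**  For every `C` and `M < ⊤` there is `Λ > 1` such that every smooth
profile `(w, q, H)` of the class (suitable weak on the slab, weak gradient, `𝐈 ≤ M`, rate `C`, classical on `(−∞,0)`)
invariant a.e. on the slab under `(t,x) ↦ l w(l²t, l x + ξ)` with `1 < l < Λ` (any `ξ`) is regular at every `(0, y)`.
This is stubs 3a (`stub_satelliteExclusion`) and 3c (`stub_centredWall`, even without its decay hypothesis) of the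
gen-5 skeleton in the range `R = 1`, `1 < l < Λ(C, M)`; the satellite half is new (Chae–Wolf's off-centre regularity,
Thm 1.1, is printed only for `C_t Lᵖ`).  Proof in the module docstring.
[cite: ChaeWolf2017RemovingDSS, Thms 1.1, 1.3; Tsai1998, Thm 1; AlbrittonBarker2019, Lemma 2.2, Prop. 2.3] -/
theorem satelliteExclusion_nearIdentity :
    ∀ (C : ℝ) (M : ℝ≥0∞), M < ⊤ → ∃ Λ : ℝ, 1 < Λ ∧ ∀ (l : ℝ), 1 < l → l < Λ →
      ∀ (w : ℝ → EuclideanSpace ℝ (Fin 3) → EuclideanSpace ℝ (Fin 3)) (q : ℝ → EuclideanSpace ℝ (Fin 3) → ℝ)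
        (H : ℝ → EuclideanSpace ℝ (Fin 3) → EuclideanSpace ℝ (Fin 3) →L[ℝ] EuclideanSpace ℝ (Fin 3))
        (ξ : EuclideanSpace ℝ (Fin 3)),
        IsSuitableWeakSolutionOn (slab (EuclideanSpace ℝ (Fin 3)) (Set.Iio 0) isOpen_Iio) 1 0 w q →
        HasWeakSpatialGradientOn (slab (EuclideanSpace ℝ (Fin 3)) (Set.Iio 0) isOpen_Iio) w H →
        typeIBound (Set.Iio (0 : ℝ) ×ˢ Set.univ) w q H ≤ M →
        HasTypeITimeDecay C w →
        IsClassicalNSSolutionOn (Set.Iio 0) 1 0 w q →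
        (fun z : ℝ × EuclideanSpace ℝ (Fin 3) => l • w (l ^ 2 * z.1) (l • z.2 + ξ))
          =ᵐ[volume.restrict (Set.Iio (0 : ℝ) ×ˢ Set.univ)] (fun z : ℝ × EuclideanSpace ℝ (Fin 3) => w z.1 z.2) →
        ∀ y : EuclideanSpace ℝ (Fin 3), ¬ IsBackwardSingularPoint w ((0 : ℝ), y) := by
  intro C M hM
  by_contra hcon
  push Not at hcon
  have hΛ : ∀ k : ℕ, (1 : ℝ) < 1 + 1 / ((k : ℝ) + 1) := fun k => by
    have : (0 : ℝ) < 1 / ((k : ℝ) + 1) := by positivity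
    linarith
  choose lam hlam1 hlamΛ w q H ξ hsw hwg hI hdec hcl hae y hsing using fun k : ℕ => hcon _ (hΛ k)
  -- `λ_k → 1`
  have hlim : Tendsto lam atTop (𝓝 1) := by
    have h1 : Tendsto (fun k : ℕ => (1 : ℝ) + 1 / ((k : ℝ) + 1)) atTop (𝓝 1) := by
      have h := (tendsto_one_div_add_atTop_nhds_zero_nat (𝕜 := ℝ)).const_add 1
      rwa [add_zero] at h
    exact tendsto_of_tendsto_of_tendsto_of_le_of_le tendsto_const_nhds h1
      (fun k => (hlam1 k).le) (fun k => (hlamΛ k).le)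
  have hl0 : ∀ k, 0 < lam k := fun k => zero_lt_one.trans (hlam1 k)
  -- ## Step 1: pointwise invariance, centres, normalised singular points
  set Rf : EuclideanSpace ℝ (Fin 3) ≃ₗᵢ[ℝ] EuclideanSpace ℝ (Fin 3) := LinearIsometryEquiv.refl ℝ _ with hRf
  have hRs : ∀ v : EuclideanSpace ℝ (Fin 3), Rf.symm v = v := fun v => rfl
  have hRa : ∀ v : EuclideanSpace ℝ (Fin 3), Rf v = v := fun v => rfl
  have hpt : ∀ k, ∀ t < (0 : ℝ), ∀ x : EuclideanSpace ℝ (Fin 3),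
      lam k • Rf.symm (w k (lam k ^ 2 * t) (lam k • Rf x + ξ k)) = w k t x := by
    intro k
    have h := rdssInvariant_pointwise_of_classical (τ := 0) Rf (ξ k) (hcl k) (hl0 k) le_rfl (by
      filter_upwards [hae k] with z hz
      simpa only [add_zero, hRs, hRa] using hz)
    intro t ht x
    simpa only [add_zero] using h t ht x
  have hpt' : ∀ k, ∀ t < (0 : ℝ), ∀ x : EuclideanSpace ℝ (Fin 3),
      lam k • w k (lam k ^ 2 * t) (lam k • x + ξ k) = w k t x := by
    intro k t ht x
    simpa only [hRs, hRa] using hpt k t ht x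
  have hcen : ∀ k, ∃ c : EuclideanSpace ℝ (Fin 3), c = lam k • Rf c + ξ k := fun k =>
    (exists_unique_rdssCentre (hlam1 k) Rf (ξ k)).exists
  choose c hc using hcen
  have hc' : ∀ k, c k = lam k • c k + ξ k := fun k => by
    simpa only [hRa] using hc k
  -- a singular point on the inverse orbit of `y k`, within distance `1` of the centre
  have hnorm : ∀ k, ∃ y' : EuclideanSpace ℝ (Fin 3), IsBackwardSingularPoint (w k) ((0 : ℝ), y') ∧ ‖y' - c k‖ ≤ 1 := by
    intro k
    obtain ⟨n, hn⟩ : ∃ n : ℕ, ‖y k - c k‖ < lam k ^ n := pow_unbounded_of_one_lt _ (hlam1 k)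
    refine ⟨(fun y : EuclideanSpace ℝ (Fin 3) => Rf.symm ((lam k)⁻¹ • (y - ξ k)))^[n] (y k), ?_, ?_⟩
    · rw [isBackwardSingularPoint_rdss_iterate_iff Rf (ξ k) (hl0 k) (hpt k) n,
        rdss_iterate_apply_inverse_iterate (hl0 k).ne' Rf (ξ k) n (y k)]
      exact hsing k
    · rw [norm_rdss_inverse_iterate_sub_centre (hl0 k) Rf (ξ k) (hc k) n (y k),
        inv_mul_le_iff₀ (pow_pos (hl0 k) n), mul_one]
      exact hn.le
  choose y' hy's hy'c using hnorm
  -- ## Step 2: translate the singular point to the origin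
  set u : ℕ → ℝ → EuclideanSpace ℝ (Fin 3) → EuclideanSpace ℝ (Fin 3) := fun k => translate (y' k) (w k) with hu
  set p : ℕ → ℝ → EuclideanSpace ℝ (Fin 3) → ℝ := fun k => translate (y' k) (q k) with hp
  set G : ℕ → ℝ → EuclideanSpace ℝ (Fin 3) → EuclideanSpace ℝ (Fin 3) →L[ℝ] EuclideanSpace ℝ (Fin 3) :=
    fun k => translate (y' k) (H k) with hG
  have hswu : ∀ k, IsSuitableWeakSolutionOn (slab (EuclideanSpace ℝ (Fin 3)) (Iio 0) isOpen_Iio) 1 0 (u k) (p k) :=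
    fun k => isSuitableWeakSolutionOn_translate (hsw k) (y' k)
  have hwgu : ∀ k, HasWeakSpatialGradientOn (slab (EuclideanSpace ℝ (Fin 3)) (Iio 0) isOpen_Iio) (u k) (G k) :=
    fun k => hasWeakSpatialGradientOn_translate (hwg k) (y' k)
  have hIu : ∀ k, typeIBound (Iio (0 : ℝ) ×ˢ univ) (u k) (p k) (G k) ≤ M := fun k => by
    show typeIBound (Iio (0 : ℝ) ×ˢ univ) (translate (y' k) (w k)) (translate (y' k) (q k))
      (translate (y' k) (H k)) ≤ M
    rw [typeIBound_translate]
    exact hI k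
  have hdecu : ∀ k, HasTypeITimeDecay C (u k) := fun k => hasTypeITimeDecay_translate (hdec k) (y' k)
  have hsingu : ∀ k, IsBackwardSingularPoint (u k) 0 := fun k =>
    (isBackwardSingularPoint_translate_iff (y' k) (w k)).2 (hy's k)
  -- shifted centres, bounded by `1`
  set a : ℕ → EuclideanSpace ℝ (Fin 3) := fun k => c k - y' k with ha
  have ha1 : ∀ k, a k ∈ closedBall (0 : EuclideanSpace ℝ (Fin 3)) 1 := fun k => by
    rw [mem_closedBall_zero_iff, ha]
    dsimp only
    rw [norm_sub_rev]
    exact hy'c k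
  -- the translates about the shifted centres are DSS about the origin, pointwise on `t < 0`
  have hV : ∀ k, ∀ t < (0 : ℝ), ∀ x : EuclideanSpace ℝ (Fin 3),
      nsRescale (lam k) (translate (a k) (u k)) t x = translate (a k) (u k) t x := fun k =>
    nsRescale_translate_translate_of_rdss (hpt' k) (hc' k) (y' k)
  -- ## Step 3: class limit, singular at the origin
  obtain ⟨W, q', H', ψ, hψ, hswW, hwgW, hIW, hdecW, hsingW, hconv⟩ :=
    stub_rlClassLimit C M hM u p G hswu hwgu hIu hdecu hsingu
  -- ## Step 4: a further subsequence along which the shifted centres converge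
  obtain ⟨aInf, -, φ, hφ, hφlim⟩ := (isCompact_closedBall (0 : EuclideanSpace ℝ (Fin 3)) 1).tendsto_subseq
    (fun j => ha1 (ψ j))
  -- data along the double subsequence
  set lam2 : ℕ → ℝ := fun j => lam (ψ (φ j)) with hlam2
  have hlam2one : ∀ j, 1 < lam2 j := fun j => hlam1 _
  have hlim2 : Tendsto lam2 atTop (𝓝 1) := (hlim.comp hψ.tendsto_atTop).comp hφ.tendsto_atTop
  have hconv2 : ∀ R : ℝ, 0 < R → Tendsto (fun j => eLpNorm (uncurry (u (ψ (φ j))) - uncurry W) 3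
      (volume.restrict (parabolicCylinder R (0 : ℝ × EuclideanSpace ℝ (Fin 3))))) atTop (𝓝 0) :=
    fun R hR => (hconv R hR).comp hφ.tendsto_atTop
  -- ## Step 5: the translates converge to the translate of the limit
  set V : ℕ → ℝ → EuclideanSpace ℝ (Fin 3) → EuclideanSpace ℝ (Fin 3) :=
    fun j => translate (a (ψ (φ j))) (u (ψ (φ j))) with hVdef
  set Wt : ℝ → EuclideanSpace ℝ (Fin 3) → EuclideanSpace ℝ (Fin 3) := translate aInf W with hWt
  have hm : ∀ j, AEStronglyMeasurable (uncurry (u (ψ (φ j))))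
      (volume.restrict (Iio (0 : ℝ) ×ˢ (univ : Set (EuclideanSpace ℝ (Fin 3))))) :=
    fun j => (hwgu _).locallyIntegrableOn.aestronglyMeasurable
  have hfin : ∀ j (R : ℝ), 0 < R → eLpNorm (uncurry (u (ψ (φ j)))) 3
      (volume.restrict (parabolicCylinder R (0 : ℝ × EuclideanSpace ℝ (Fin 3)))) < ⊤ :=
    fun j R hR => (memLp_three_of_slabProfile (hwgu _) (lt_of_le_of_lt (hIu _) hM) hR).2
  have hWm : AEStronglyMeasurable (uncurry W)
      (volume.restrict (Iio (0 : ℝ) ×ˢ (univ : Set (EuclideanSpace ℝ (Fin 3))))) :=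
    hwgW.locallyIntegrableOn.aestronglyMeasurable
  have hconvV : ∀ R : ℝ, 0 < R → Tendsto (fun j => eLpNorm (uncurry (V j) - uncurry Wt) 3
      (volume.restrict (parabolicCylinder R (0 : ℝ × EuclideanSpace ℝ (Fin 3))))) atTop (𝓝 0) :=
    fun R hR => tendsto_eLpNorm_translate_sub (uk := fun j => u (ψ (φ j))) (xk := fun j => a (ψ (φ j)))
      hm hfin hWm hconv2 hφlim hR
  -- class data of the translates and of the translated limit
  have hswV : ∀ j, IsSuitableWeakSolutionOn (slab (EuclideanSpace ℝ (Fin 3)) (Iio 0) isOpen_Iio) 1 0 (V j)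
      (translate (a (ψ (φ j))) (p (ψ (φ j)))) := fun j => isSuitableWeakSolutionOn_translate (hswu _) _
  have hwgV : ∀ j, HasWeakSpatialGradientOn (slab (EuclideanSpace ℝ (Fin 3)) (Iio 0) isOpen_Iio) (V j)
      (translate (a (ψ (φ j))) (G (ψ (φ j)))) := fun j => hasWeakSpatialGradientOn_translate (hwgu _) _
  have hswWt : IsSuitableWeakSolutionOn (slab (EuclideanSpace ℝ (Fin 3)) (Iio 0) isOpen_Iio) 1 0 Wt
      (translate aInf q') := isSuitableWeakSolutionOn_translate hswW aInf
  have hwgWt : HasWeakSpatialGradientOn (slab (EuclideanSpace ℝ (Fin 3)) (Iio 0) isOpen_Iio) Wt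
      (translate aInf H') := hasWeakSpatialGradientOn_translate hwgW aInf
  have hIWt : typeIBound (Iio (0 : ℝ) ×ˢ univ) Wt (translate aInf q') (translate aInf H') < ⊤ := by
    rw [hWt, typeIBound_translate]
    exact hIW
  have hdecWt : HasTypeITimeDecay C Wt := hasTypeITimeDecay_translate hdecW aInf
  -- measurability of the rescaled fields on the balls
  have hmeasV : ∀ (j : ℕ) (cc : ℝ), 0 < cc → ∀ R : ℝ, 0 < R →
      AEStronglyMeasurable (uncurry (nsRescale cc (V j)))
        (volume.restrict (parabolicCylinder R (0 : ℝ × EuclideanSpace ℝ (Fin 3)))) := by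
    intro j cc hcc R _
    rw [nsRescale_eq_zoom]
    exact (zoom_slabProfile (hswV j) (hwgV j) hcc).2.1.locallyIntegrableOn.aestronglyMeasurable.mono_measure
      (Measure.restrict_mono (parabolicCylinder_origin_subset_slab _) le_rfl)
  have hmeasWt : ∀ (cc : ℝ), 0 < cc → ∀ R : ℝ, 0 < R →
      AEStronglyMeasurable (uncurry (nsRescale cc Wt))
        (volume.restrict (parabolicCylinder R (0 : ℝ × EuclideanSpace ℝ (Fin 3)))) := by
    intro cc hcc R _
    rw [nsRescale_eq_zoom]
    exact (zoom_slabProfile hswWt hwgWt hcc).2.1.locallyIntegrableOn.aestronglyMeasurable.mono_measure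
      (Measure.restrict_mono (parabolicCylinder_origin_subset_slab _) le_rfl)
  -- the scaling orbit of the translated limit is continuous in `L³` on the balls
  have horbit := stub_rlOrbitContinuous Wt (fun R hR => memLp_three_of_slabProfile hwgWt hIWt hR)
  -- the translates are DSS about the origin, a.e. on the slab
  have hdssV : ∀ j, ∀ᵐ z ∂(volume.restrict (Iio (0 : ℝ) ×ˢ (univ : Set (EuclideanSpace ℝ (Fin 3))))),
      nsRescale (lam2 j) (V j) z.1 z.2 = V j z.1 z.2 := fun j =>
    ae_restrict_of_forall_mem (measurableSet_Iio.prod MeasurableSet.univ) fun z hz => hV _ z.1 hz.1 z.2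
  -- ## Step 6: the translated limit is a.e. self-similar
  have hpos : ∀ σ : ℝ, 0 < σ → ∀ᵐ z ∂(volume.restrict (Iio (0 : ℝ) ×ˢ (univ : Set (EuclideanSpace ℝ (Fin 3))))),
      nsRescale (Real.exp σ) Wt z.1 z.2 = Wt z.1 z.2 := by
    intro σ hσ
    have hball : ∀ R : ℝ, 0 < R →
        ∀ᵐ z ∂(volume.restrict (parabolicCylinder R (0 : ℝ × EuclideanSpace ℝ (Fin 3)))),
          nsRescale (Real.exp σ) Wt z.1 z.2 = Wt z.1 z.2 := by
      intro R hR
      have h0 := rlNearIdentityDSS_ball (lam := lam2) hlam2one hlim2 (u := V) hmeasV hmeasWt hconvV hdssV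
        horbit hσ hR
      have hwm1 : AEStronglyMeasurable (uncurry Wt)
          (volume.restrict (parabolicCylinder R (0 : ℝ × EuclideanSpace ℝ (Fin 3)))) := by
        have h := hmeasWt 1 one_pos R hR
        rwa [nsRescale_one] at h
      rw [eLpNorm_eq_zero_iff ((hmeasWt _ (Real.exp_pos σ) R hR).sub hwm1) (by norm_num)] at h0
      filter_upwards [h0] with z hz
      rw [Pi.sub_apply, Pi.zero_apply, sub_eq_zero] at hz
      exact hz
    refine ae_restrict_of_ae_restrict_of_subset lowerHalf_subset_iUnion_parabolicCylinder ?_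
    rw [ae_restrict_iUnion_iff]
    intro n
    exact hball _ (by positivity)
  have hss : ∀ σ : ℝ, ∀ᵐ z ∂(volume.restrict (Iio (0 : ℝ) ×ˢ (univ : Set (EuclideanSpace ℝ (Fin 3))))),
      nsRescale (Real.exp σ) Wt z.1 z.2 = Wt z.1 z.2 := by
    intro σ
    rcases lt_trichotomy σ 0 with hneg | hzero | hposσ
    · have h := rlNearIdentityDSS_ae_inv (Real.exp_pos (-σ)) (hpos (-σ) (neg_pos.2 hneg))
      rwa [← Real.exp_neg, neg_neg] at h
    · subst hzero
      exact Eventually.of_forall fun z => by rw [Real.exp_zero, nsRescale_one]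
    · exact hpos σ hposσ
  -- ## Step 7: hence it vanishes a.e. (Tsai), and so does the limit: contradiction with its singular origin
  obtain ⟨v, hv, hvss, hae'⟩ := stub_rlSelfSimilarRepr C Wt _ _ hswWt hwgWt hIWt hdecWt hss
  have hv0 : ∀ t : ℝ, t < 0 → ∀ x, v t x = 0 := stub_rlSelfSimilarMildVanishes C v hv hvss
  have hWt0 : ∀ᵐ z ∂(volume.restrict (Iio (0 : ℝ) ×ˢ (univ : Set (EuclideanSpace ℝ (Fin 3))))),
      uncurry Wt z = (0 : EuclideanSpace ℝ (Fin 3)) := by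
    filter_upwards [hae', ae_restrict_mem (measurableSet_Iio.prod MeasurableSet.univ)] with z hz hzm
    rw [hz]
    exact hv0 z.1 hzm.1 z.2
  have hW0 : ∀ᵐ z ∂(volume.restrict (Iio (0 : ℝ) ×ˢ (univ : Set (EuclideanSpace ℝ (Fin 3))))),
      uncurry W z = (0 : ℝ × EuclideanSpace ℝ (Fin 3) → EuclideanSpace ℝ (Fin 3)) z := by
    have h := ae_zero_slab_translate (-aInf) hWt0
    filter_upwards [h] with z hz
    rw [Pi.zero_apply, ← hz]
    show W z.1 z.2 = W z.1 (aInf + (-aInf + z.2))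
    rw [add_neg_cancel_left]
  have hQ : ∀ᵐ z ∂(volume.restrict (parabolicCylinder 1 (0 : ℝ × EuclideanSpace ℝ (Fin 3)))),
      uncurry W z = (0 : ℝ × EuclideanSpace ℝ (Fin 3) → EuclideanSpace ℝ (Fin 3)) z :=
    ae_restrict_of_ae_restrict_of_subset (parabolicCylinder_origin_subset_slab 1) hW0
  have h0 : eLpNorm (uncurry W) ∞
      (volume.restrict (parabolicCylinder 1 (0 : ℝ × EuclideanSpace ℝ (Fin 3)))) = 0 := by
    rw [eLpNorm_congr_ae hQ, eLpNorm_zero]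
  have htop := hsingW 1 one_pos
  rw [h0] at htop
  exact ENNReal.zero_ne_top htop

end Summit.NavierStokesRegularity.NavierStokesRegularity.Theorems.SymmetryModuliCountForcedSymmetry

end
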